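/-
Copyright (c) 2026 the pub-hodgecm-mathlib formalisation cell (harness21).  Prover seat hodgecm-mathlib-K2E2-p12 (g2), Track B «K2-LIT», engine E2, unit CAPTURE,
socket #20a line lead, 2026-09-03∕04.  KERNEL module: THEOREMS ONLY (no definition, no named fact, no `sorry`, no instance, no notation).
-/
import Literature.NumberTheory.GelbartRogawski1991.UnitaryDualPairThetaLiftSplittingTwist   -- ★ `pairRep_twist_apply_refl` (+ ★ `Weil1964.ThetaLiftTransportAdelic` by import)
import Summits.HodgeConjecture.HodgeConjecture.Theorems.H413RallisTransportConsumption       -- ★ `exists_twist_lineRepOf_zero`, `mem_CMRat_iff_mem_regimeRat` (the model's (T)-shape)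
import Summits.HodgeConjecture.HodgeConjecture.Theorems.H413CharacterKnobSolve              -- ★ `mul_inv_inv_mul_cancel_aux` (the knob algebra)
import Summits.HodgeConjecture.HodgeCM.Model.ArchSideOfTwist                                -- ★ `etaT₀_apply_mk_one`
import HarnessLib

set_option autoImplicit false
-- the mandated namespace has the single-problem summit's repeated segment (`HodgeConjecture.HodgeConjecture`)
set_option linter.dupNamespace false

/-!
# K2 ∕ E2 «ThetaExhaustionByRigidity», unit CAPTURE, socket #20a «ARCH-PAIR-HOLCOT» — H1 «KERNEL IDENTITY»:
# the model's slot-0 theta lift (engine's side) IS the CM dual pair's lift at the twisted splitting `s₀ ⊗ ĉ`, POINTWISE, with NO `U(V)` scalar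

Cell hodgecm-mathlib (D-0151), FLOOR 0, Track B «K2-LIT», engine E2, crux item H413 = stmt-HodgeConjecture-24833 (route `HCCMUnconditional`).  Socket #20a
`Capture.sig_K2E2CapArchPairHolCot` (dealer K2E2-plan (g2) 2026-09-03T23:27Z; line lead K2E2-p12 (g2)); helper H1 of the line-lead structure (K2 bus 23:32Z).
The three ★ bridges of `H413ThetaDistNeZeroOfThetaLift` are «≠ 0 ↔ ≠ 0» statements; #20a needs them POINTWISE, with the scalars:
§1 `thetaLift_twist_splitting_mul_apply_mk` (generic GR91 pair: `Θ^{s⊗ĉ}_Φ(f·κ)(xΓ) = ĉ(x⊗1)⁻¹·Θ^{s}_Φ(f)(xΓ)`; ★ `pairRep_twist_apply_refl` + ★ `thetaLift_apply_of_twist`);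
§2 `kernelDatum_thetaLift_comp_mul_apply_mk` (model `P` with `P.ω = lineRepOf … 0`: `Θ^{P}_Φ((f∘a)·κ)(x′Γ) = (η₀(x̂,1)·χ₀(x̂,1))⁻¹·Θ^{s₀}_Φ(f)(x̂Γ)`, `x̂ = eU x′`,
`s₀ = splittingOf hGR₀`; ★ (T)-shape `exists_twist_lineRepOf_zero`); §3 `etaT₀_one_knob_mul_cmLineChar₀` (for the ENGINE's side `η := 1`, knob `ν := χ₀(·,1)·(ĉ∘ι_V)⁻¹` of ★
`H413CharacterKnobSolve`, that scalar IS `ĉ(x̂⊗1)⁻¹` — the seat's finding K2 bus 23:29Z: the knob cancels the splitting twist on `U(V)` EXACTLY); §4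
`kernelDatum_thetaLift_eq_twist_splitting_thetaLift` (hence `Θ^{P}_Φ((f∘a)·κ₁)(x′Γ) = Θ^{s₀⊗ĉ}_Φ(f·κ₂)(x̂Γ)`; for the engine `s₀ ⊗ ĉ =` the `μ`-splitting
`chiSplitting … (toHeckeCharacter μ)`, ★ `exists_coinv_equiv_TW_splittingOf_adelic`: the model's harmonic theta forms ARE line theta lifts at the `μ`-splitting).
`--supports stmt-HodgeConjecture-24833 --as helper`; THEOREMS ONLY; imports ★ only (0 `Lines`).  HONEST LABEL: HC_CM is proved only modulo the 7 printed citations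
(2 remaining named inputs: hLiu418 = stmt-HodgeConjecture-24832, h413 = stmt-HodgeConjecture-24833) until rung 0 closes; this file discharges no printed citation.
References: [GelbartRogawski1991] Invent. Math. 105 (1991) §3.1 Prop. 3.1.1 p. 455, Remark p. 457 L4–13; [Weil1964] Acta Math. 111 (1964) n° 41 Thm 6 p. 193;
[Howe1979] PSPM 33.1 §3; [Liu2021] Camb. J. Math. 9 (2021) App. D §D.1 Steps 1–3; [FleigEtAl2018] CUP (2018) §12.3 Def. 12.5 (12.37).
-/

noncomputable section

open _root_.MeasureTheory
open scoped Matrix Kronecker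
open NumberField hiding relNormOneIdeles relNormOneRat probHaarRelNormOneQuot
open Literature.NumberTheory.Automorphic Literature.NumberTheory.Automorphic.UnitaryGroup Literature.NumberTheory.Weil1964
open Literature.NumberTheory.Weil1964.ThetaKernelDatum
open Literature.MeasureTheory.Group
open Literature.NumberTheory.GelbartRogawski1991 Literature.NumberTheory.GelbartRogawski1991.UnitaryDualPair

namespace Summit.HodgeConjecture.HodgeConjecture.Cruxes.H413.K2E2CapArchKernelIdentity

/-! ## §1 The splitting twist, pointwise -/

section SplittingTwist

variable (F E : Type) [Field F] [NumberField F] [Field E] [NumberField E] [Algebra F E]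
variable (c : E ≃ₐ[F] E) (N M : ℕ) {n : ℕ} (e : Fin N × Fin M ≃ Fin n)
variable (JV : Matrix (Fin N) (Fin N) E) (JW : Matrix (Fin M) (Fin M) E)
variable {TV : Matrix (Fin N) (Fin N) F} {TW : Matrix (Fin M) (Fin M) F}
variable [Algebra.IsQuadraticExtension F E] {δ : E} (hcδ : c δ = -δ) (hδ : δ ≠ 0) {d : F}
  (hd : δ * δ = algebraMap F E d) (hV : TV.IsSymm) (hW : TW.IsSymm) (hVd : IsUnit TV.det) (hWd : IsUnit TW.det)
  (hJV : JV = TV.map (algebraMap F E)) (hJW : JW = TW.map (algebraMap F E))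
variable [LocallyCompactSpace (UnitaryGroup.adelic F E c N JV)] [LocallyCompactSpace (UnitaryGroup.adelic F E c M JW)]
variable {s : UnitaryGroup.adelicPair F E c N M JV JW →* adelicMpCont F (Fin n) (adelicGram F e TV TW)}
  (hs : (splittingDatum F E c N M e JV JW hcδ hδ hd hV hW hVd hWd hJV hJW).IsCompatible s)
  (ĉ : UnitaryGroup.adelicPair F E c N M JV JW →* ℂˣ)
  (hs' : (splittingDatum F E c N M e JV JW hcδ hδ hd hV hW hVd hWd hJV hJW).IsCompatible
    (adelicMpCont.twist F (Fin n) (adelicGram F e TV TW) s ĉ))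
  (hρ : HasThetaMajorants fun (p : UnitaryGroup.adelic F E c N JV × UnitaryGroup.adelic F E c M JW)
    (Φ : piSchwartzBruhat F (Fin n)) => pairRep F E c N M e JV JW s p Φ)
  (SK : Set (piSchwartzBruhat F (Fin n)))
  (hSK : ∀ (h : UnitaryGroup.adelic F E c M JW) (Φ : piSchwartzBruhat F (Fin n)), Φ ∈ SK →
    pairRep F E c N M e JV JW s (1, h) Φ ∈ SK)
  (hρ' : HasThetaMajorants fun (p : UnitaryGroup.adelic F E c N JV × UnitaryGroup.adelic F E c M JW)
    (Φ : piSchwartzBruhat F (Fin n)) => pairRep F E c N M e JV JW (adelicMpCont.twist F (Fin n) (adelicGram F e TV TW) s ĉ) p Φ)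
  (SK' : Set (piSchwartzBruhat F (Fin n)))
  (hSK' : ∀ (h : UnitaryGroup.adelic F E c M JW) (Φ : piSchwartzBruhat F (Fin n)), Φ ∈ SK' →
    pairRep F E c N M e JV JW (adelicMpCont.twist F (Fin n) (adelicGram F e TV TW) s ĉ) (1, h) Φ ∈ SK')
  [CompactSpace (UnitaryGroup.adelic F E c N JV ⧸ (UnitaryGroup.toAdelic F E c N JV).range)]
  [CompactSpace (UnitaryGroup.adelic F E c M JW ⧸ (UnitaryGroup.toAdelic F E c M JW).range)]
  [MeasurableSpace (UnitaryGroup.adelic F E c M JW ⧸ (UnitaryGroup.toAdelic F E c M JW).range)]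
  [BorelSpace (UnitaryGroup.adelic F E c M JW ⧸ (UnitaryGroup.toAdelic F E c M JW).range)]
  (μ : Measure (UnitaryGroup.adelic F E c M JW ⧸ (UnitaryGroup.toAdelic F E c M JW).range)) [IsFiniteMeasure μ]

include hs hs' in
/-- **THE SPLITTING TWIST, POINTWISE**: `Θ^{s⊗ĉ}_Φ(f·κ)(xΓ) = ĉ(x ⊗ 1)⁻¹ · Θ^{s}_Φ(f)(xΓ)` for the compatible splittings `s`, `s ⊗ ĉ`, the continuous
multiplier `κ([h]) = ĉ(1 ⊗ h)`, every finite `μ`, `Φ`, `f`, `x` — ★ `thetaLift_apply_of_twist` with identity carriers and `c := ĉ ∘ pairMap` (`c₂ = κ⁻¹` cancels `κ`).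
[cite: GelbartRogawski1991, §3.1 Remark p. 457 L4–13] [cite: Weil1964, Chap. III n° 41 Thm 6 p. 193] [cite: FleigEtAl2018, §12.3 Def. 12.5 (12.37)] -/
theorem thetaLift_twist_splitting_mul_apply_mk
    (κ : C(UnitaryGroup.adelic F E c M JW ⧸ (UnitaryGroup.toAdelic F E c M JW).range, ℂ))
    (hκ : ∀ h : UnitaryGroup.adelic F E c M JW,
      κ (QuotientGroup.mk h) = ((ĉ (UnitaryGroup.adelicInr F E c N M JV JW h) : ℂˣ) : ℂ))
    (Φ : piSchwartzBruhat F (Fin n)) (f : C(UnitaryGroup.adelic F E c M JW ⧸ (UnitaryGroup.toAdelic F E c M JW).range, ℂ))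
    (x : UnitaryGroup.adelic F E c N JV) :
    (thetaKernelDatum F E c N M e JV JW hcδ hδ hd hV hW hVd hWd hJV hJW
          (adelicMpCont.twist F (Fin n) (adelicGram F e TV TW) s ĉ) hs' hρ' SK' hSK').thetaLift μ Φ (f * κ) (QuotientGroup.mk x) =
      (((ĉ (UnitaryGroup.adelicInl F E c N M JV JW x))⁻¹ : ℂˣ) : ℂ) *
        (thetaKernelDatum F E c N M e JV JW hcδ hδ hd hV hW hVd hWd hJV hJW s hs hρ SK hSK).thetaLift μ Φ f (QuotientGroup.mk x) := by
  have hωω' : ∀ (p : UnitaryGroup.adelic F E c N JV × UnitaryGroup.adelic F E c M JW) (Φ : piSchwartzBruhat F (Fin n)),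
      pairRep F E c N M e JV JW (adelicMpCont.twist F (Fin n) (adelicGram F e TV TW) s ĉ) p Φ =
        (((ĉ.comp (pairMap F E c N M JV JW)) p : ℂˣ) : ℂ) •
          pairRep F E c N M e JV JW s ((MulEquiv.refl _) p.1, (MulEquiv.refl _) p.2) Φ :=
    fun p Φ => pairRep_twist_apply_refl F E c N M e JV JW s ĉ p Φ
  have hκ' : ∀ h : UnitaryGroup.adelic F E c M JW, κ (QuotientGroup.mk h) =
      (((ĉ.comp (pairMap F E c N M JV JW)) (1, h) : ℂˣ) : ℂ) := fun h => by
    rw [hκ, MonoidHom.comp_apply, pairMap_apply, map_one, one_mul]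
  have hκ0 : ∀ q : UnitaryGroup.adelic F E c M JW ⧸ (UnitaryGroup.toAdelic F E c M JW).range, κ q ≠ 0 := fun q => by
    induction q using QuotientGroup.induction_on with
    | H h => rw [hκ' h]; exact Units.ne_zero _
  let c₂ : C(UnitaryGroup.adelic F E c M JW ⧸ (UnitaryGroup.toAdelic F E c M JW).range, ℂ) :=
    ⟨fun q => (κ q)⁻¹, κ.continuous.inv₀ hκ0⟩
  have hc₂ : ∀ h : UnitaryGroup.adelic F E c M JW, c₂ (QuotientGroup.mk h) =
      ((((ĉ.comp (pairMap F E c N M JV JW)) (1, h))⁻¹ : ℂˣ) : ℂ) := fun h => by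
    simp only [c₂, ContinuousMap.coe_mk, hκ' h, Units.val_inv_eq_inv_val]
  obtain ⟨c₁, hc₁⟩ := exists_twist_descend_left (ΓU := (UnitaryGroup.toAdelic F E c N JV).range)
    (Γ := (UnitaryGroup.toAdelic F E c M JW).range) (ΓU' := (UnitaryGroup.toAdelic F E c N JV).range)
    (Γ' := (UnitaryGroup.toAdelic F E c M JW).range)
    (pairRep F E c N M e JV JW s)
    (fun _ hγU _ hγ => pairRep_toHomUnits_mem_thetaStabilizer F E c N M e JV JW hcδ hδ hd hV hW hVd hWd hJV hJW hs hγU hγ)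
    (pairRep F E c N M e JV JW (adelicMpCont.twist F (Fin n) (adelicGram F e TV TW) s ĉ))
    (fun _ hγU _ hγ => pairRep_toHomUnits_mem_thetaStabilizer F E c N M e JV JW hcδ hδ hd hV hW hVd hWd hJV hJW hs' hγU hγ)
    (MulEquiv.refl _) (fun _ => Iff.rfl) (MulEquiv.refl _) (fun _ => Iff.rfl)
    (ĉ.comp (pairMap F E c N M JV JW)) hωω'
  have key := thetaLift_apply_of_twist (ΓU := (UnitaryGroup.toAdelic F E c N JV).range)
    (Γ := (UnitaryGroup.toAdelic F E c M JW).range) (ΓU' := (UnitaryGroup.toAdelic F E c N JV).range)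
    (Γ' := (UnitaryGroup.toAdelic F E c M JW).range)
    (pairRep F E c N M e JV JW s) hρ
    (fun _ hγU _ hγ => pairRep_toHomUnits_mem_thetaStabilizer F E c N M e JV JW hcδ hδ hd hV hW hVd hWd hJV hJW hs hγU hγ)
    SK hSK
    (pairRep F E c N M e JV JW (adelicMpCont.twist F (Fin n) (adelicGram F e TV TW) s ĉ)) hρ'
    (fun _ hγU _ hγ => pairRep_toHomUnits_mem_thetaStabilizer F E c N M e JV JW hcδ hδ hd hV hW hVd hWd hJV hJW hs' hγU hγ)
    SK' hSK' (MulEquiv.refl _) (fun _ => Iff.rfl) (MulEquiv.refl _) (fun _ => Iff.rfl)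
    (ĉ.comp (pairMap F E c N M JV JW)) hωω' μ continuous_id continuous_id c₁ hc₁ c₂ hc₂ Φ (f * κ) (QuotientGroup.mk x)
  have hid : cosetCongr (MulEquiv.refl (UnitaryGroup.adelic F E c N JV)) (UnitaryGroup.toAdelic F E c N JV).range
      (UnitaryGroup.toAdelic F E c N JV).range (fun _ => Iff.rfl) = id := by
    funext q
    induction q using QuotientGroup.induction_on with
    | H g => rfl
  have hidW : cosetCongr (MulEquiv.refl (UnitaryGroup.adelic F E c M JW)) (UnitaryGroup.toAdelic F E c M JW).range
      (UnitaryGroup.toAdelic F E c M JW).range (fun _ => Iff.rfl) = id := by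
    funext q
    induction q using QuotientGroup.induction_on with
    | H g => rfl
  have hf : (c₂ * (f * κ)).comp ⟨cosetCongr (MulEquiv.refl (UnitaryGroup.adelic F E c M JW)).symm (UnitaryGroup.toAdelic F E c M JW).range
      (UnitaryGroup.toAdelic F E c M JW).range (forall_symm_mem_iff (MulEquiv.refl _) _ _ (fun _ => Iff.rfl)),
      continuous_cosetCongr _ _ _ _ continuous_id⟩ = f := by
    ext q
    induction q using QuotientGroup.induction_on with
    | H h =>
      show c₂ (QuotientGroup.mk h) * (f (QuotientGroup.mk h) * κ (QuotientGroup.mk h)) = f (QuotientGroup.mk h)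
      have h0 := hκ0 (QuotientGroup.mk h)
      simp only [c₂, ContinuousMap.coe_mk]
      field_simp
  have hc₁x : c₁ (QuotientGroup.mk x) = (((ĉ (UnitaryGroup.adelicInl F E c N M JV JW x))⁻¹ : ℂˣ) : ℂ) := by
    rw [hc₁, MonoidHom.comp_apply, pairMap_apply, map_one, mul_one]
  rw [hf, hidW, Measure.map_id, hid, hc₁x] at key
  exact key

end SplittingTwist

/-! ## §2–§4 The model's slot-0 lift: versus `splittingOf hGR₀` (§2), the knob cancellation (§3), versus `splittingOf hGR₀ ⊗ ĉ` (§4) -/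

section Model

open HodgeCM HodgeCM.Adelic HodgeCM.PerL34 HodgeCM.Model HodgeCM.Model.ArchSideTerm HodgeCM.Model.SupplyResidual
open Summit.HodgeConjecture.HodgeConjecture.Cruxes.H413.RallisTransport
open Summit.HodgeConjecture.HodgeConjecture.Cruxes.H413.ThetaJunction (mul_inv_inv_mul_cancel_aux)

variable {L : CMField} {ι₁ : L →+* ℂ} (V : HermSpace3 L ι₁) (S : StubTree.SeesawDatum L)
variable
  (hGR : (cmSplittingDatum (L : Type) finProdFinEquiv (frameD V) (frameD_real V) (frameD_ne V) (dW S) (dW_real S) (dW_ne S)).CompatibleSplitting)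
  (hGR₀ : (cmSplittingDatum (L : Type) (e₁) (frameD V) (frameD_real V) (frameD_ne V) (lineVec (L : Type) (dW S 0))
    (fun _ => dW_real S 0) (fun _ => dW_ne S 0)).CompatibleSplitting)
  (hGR₁ : (cmSplittingDatum (L : Type) (e₁) (frameD V) (frameD_real V) (frameD_ne V) (lineVec (L : Type) (dW S 1))
    (fun _ => dW_real S 1) (fun _ => dW_ne S 1)).CompatibleSplitting)
  (hGR₂ : (cmSplittingDatum (L : Type) (e₁) (frameD V) (frameD_real V) (frameD_ne V) (lineVec (L : Type) (dW' S 0))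
    (fun _ => dW'_real S 0) (fun _ => dW'_ne S 0)).CompatibleSplitting)
  (hGR₃ : (cmSplittingDatum (L : Type) (e₁) (frameD V) (frameD_real V) (frameD_ne V) (lineVec (L : Type) (dW' S 1))
    (fun _ => dW'_real S 1) (fun _ => dW'_ne S 1)).CompatibleSplitting)
  (η₀ η₁ η₂ η₃ : CMAdelic (L : Type) (frameD V) × CMAdelicOne (L : Type) →* ℂˣ)
  (eU : ↥(regimeSubgroup L V.Hm) ≃* CMAdelic (L : Type) (frameD V))
  (heU : ∀ x : ↥(regimeSubgroup L V.Hm),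
    eU x = cmFrameEquiv (L : Type) (frameG V) V.Hm (frameD V) (frame_congr V) (x : ↥(HodgeCM.Adelic.adelicUnitaryGroup (L : Type) V.Hm)))
  (e : ↥(relNormOneIdeles (↥(maximalRealSubfield L)) L) ≃* CMAdelic (L : Type) (lineVec (L : Type) (dW S 0)))
  (he : ∀ t : ↥(relNormOneIdeles (↥(maximalRealSubfield L)) L),
    e t = CMCenter (L : Type) (lineVec (L : Type) (dW S 0)) ((cmAdelicOneEquivRelNormOne (L : Type)).symm t))
  (hΓ : ∀ t : ↥(relNormOneIdeles (↥(maximalRealSubfield L)) L),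
    e t ∈ CMRat (L : Type) (lineVec (L : Type) (dW S 0)) ↔ t ∈ relNormOneRat (↥(maximalRealSubfield L)) L)
  (hρ : HasThetaMajorants fun
    (p : CMAdelic (L : Type) (frameD V) × CMAdelic (L : Type) (lineVec (L : Type) (dW S 0)))
    (Φ : piSchwartzBruhat (↥(maximalRealSubfield L)) (Fin 3)) =>
      cmPairRep (L : Type) e₁ (frameD V) (frameD_real V) (frameD_ne V) (lineVec (L : Type) (dW S 0))
        (fun _ => dW_real S 0) (fun _ => dW_ne S 0) hGR₀ p Φ)
  (SK : Set (piSchwartzBruhat (↥(maximalRealSubfield L)) (Fin 3)))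
  (hSK : ∀ (h : CMAdelic (L : Type) (lineVec (L : Type) (dW S 0))) (Φ : piSchwartzBruhat (↥(maximalRealSubfield L)) (Fin 3)),
    Φ ∈ SK → cmPairRep (L : Type) e₁ (frameD V) (frameD_real V) (frameD_ne V) (lineVec (L : Type) (dW S 0))
      (fun _ => dW_real S 0) (fun _ => dW_ne S 0) hGR₀ (1, h) Φ ∈ SK)

/-- **THE KNOB CANCELS THE SPLITTING TWIST ON `U(V)`** (seat finding, K2 bus 2026-09-03T23:29Z): with `η := 1` and the knob `ν := χ₀(·,1)·κ⁻¹` (★ `H413CharacterKnobSolve`,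
`κ = ĉ ∘ ι_V`), the `U(V)`-scalar of §2 is `η₀(x,1)·χ₀(x,1) = κ(x)`; ★ `etaT₀_apply_mk_one` and `(a·b⁻¹)⁻¹·a = b`. [cite: GelbartRogawski1991, §3.1 Remark p. 457 L4–13] -/
theorem etaT₀_one_knob_mul_cmLineChar₀ (κ : CMAdelic (L : Type) (frameD V) →* ℂˣ) (x : CMAdelic (L : Type) (frameD V)) :
    etaT₀ V S (1 : CMAdelic (L : Type) (frameD V) × CMAdelic (L : Type) (dW S) →* ℂˣ)
          ((cmLineChar₀ (L : Type) finProdFinEquiv e₁ (frameD V) (frameD_real V) (frameD_ne V) (dW S) (dW_real S) (dW_ne S) hGR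
              hGR₀ hGR₁).comp (MonoidHom.inl _ _) * κ⁻¹) (x, 1) *
        cmLineChar₀ (L : Type) finProdFinEquiv e₁ (frameD V) (frameD_real V) (frameD_ne V) (dW S) (dW_real S) (dW_ne S) hGR hGR₀ hGR₁
          (x, 1) = κ x := by
  rw [etaT₀_apply_mk_one, MonoidHom.one_apply, mul_one, MonoidHom.mul_apply, MonoidHom.comp_apply, MonoidHom.inl_apply,
    MonoidHom.inv_apply]
  exact mul_inv_inv_mul_cancel_aux _ _

variable
  [MeasurableSpace (CMAdelic (L : Type) (lineVec (L : Type) (dW S 0)) ⧸ CMRat (L : Type) (lineVec (L : Type) (dW S 0)))]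
  [BorelSpace (CMAdelic (L : Type) (lineVec (L : Type) (dW S 0)) ⧸ CMRat (L : Type) (lineVec (L : Type) (dW S 0)))]
  [CompactSpace (CMAdelic (L : Type) (frameD V) ⧸ CMRat (L : Type) (frameD V))]
  [CompactSpace (CMAdelic (L : Type) (lineVec (L : Type) (dW S 0)) ⧸ CMRat (L : Type) (lineVec (L : Type) (dW S 0)))]
  (μ' : Measure (↥(relNormOneIdeles (↥(maximalRealSubfield L)) L) ⧸ relNormOneRat (↥(maximalRealSubfield L)) L))
  [IsFiniteMeasure μ']

include heU he in
/-- **MODEL → CM PAIR AT `s₀ = splittingOf hGR₀`, POINTWISE**: for a model pair datum `P` (`P.ω = lineRepOf … 0`, `P.ΓU = regimeRat`), the continuous multiplier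
`κ` on `[U(1)]` descending `t ↦ η₀(1, t♭)·χ₀(1, e t)`, `a = cosetCongr e`, `x̂ = eU x′`:
`P.kernelDatum.thetaLift μ′ Φ ((f ∘ a)·κ) (x′Γ) = (η₀(x̂,1)·χ₀(x̂,1))⁻¹ · (cmThetaKernelDatum … hGR₀ …).thetaLift (a_*μ′) Φ f (x̂Γ)` — ★ (T) `exists_twist_lineRepOf_zero` fed to ★
`thetaLift_apply_of_twist` (its «≠ 0 ↔ ≠ 0» form is ★ `kernelDatum_thetaLift_comp_mul_ne_zero_iff`).
[cite: Howe1979, §3] [cite: GelbartRogawski1991, §3.1 Remark p. 457 L4–13] [cite: Weil1964, Chap. III n° 41 Thm 6 p. 193] [cite: FleigEtAl2018, §12.3 Def. 12.5 (12.37)] -/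
theorem kernelDatum_thetaLift_comp_mul_apply_mk
    (P : WeilPairData (↥(maximalRealSubfield L)) (L : Type) (Fin 3) ↥(regimeSubgroup L V.Hm))
    (hPω : P.ω = lineRepOf V S hGR hGR₀ hGR₁ hGR₂ hGR₃ η₀ η₁ η₂ η₃ 0) (hPΓ : P.ΓU = regimeRat L V.Hm)
    [CompactSpace (↥(regimeSubgroup L V.Hm) ⧸ P.ΓU)]
    (hcont : Continuous e) (hconts : Continuous e.symm)
    (κ : C(↥(relNormOneIdeles (↥(maximalRealSubfield L)) L) ⧸ relNormOneRat (↥(maximalRealSubfield L)) L, ℂ))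
    (hκ : ∀ t : ↥(relNormOneIdeles (↥(maximalRealSubfield L)) L),
      κ (QuotientGroup.mk t) =
        ((η₀ (1, (cmAdelicOneEquivRelNormOne (L : Type)).symm t) *
            cmLineChar₀ (L : Type) finProdFinEquiv e₁ (frameD V) (frameD_real V) (frameD_ne V) (dW S) (dW_real S) (dW_ne S)
              hGR hGR₀ hGR₁ (1, e t) : ℂˣ) : ℂ))
    (Φ : piSchwartzBruhat (↥(maximalRealSubfield L)) (Fin 3))
    (f : C(CMAdelic (L : Type) (lineVec (L : Type) (dW S 0)) ⧸ CMRat (L : Type) (lineVec (L : Type) (dW S 0)), ℂ))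
    (x' : ↥(regimeSubgroup L V.Hm)) :
    P.kernelDatum.thetaLift μ' (P.weilDatum.toThetaTop Φ)
        (f.comp ⟨cosetCongr e (relNormOneRat (↥(maximalRealSubfield L)) L) (CMRat (L : Type) (lineVec (L : Type) (dW S 0))) hΓ,
          continuous_cosetCongr e _ _ hΓ hcont⟩ * κ) (QuotientGroup.mk x') =
      (((η₀ (eU x', 1) *
            cmLineChar₀ (L : Type) finProdFinEquiv e₁ (frameD V) (frameD_real V) (frameD_ne V) (dW S) (dW_real S) (dW_ne S)
              hGR hGR₀ hGR₁ (eU x', 1))⁻¹ : ℂˣ) : ℂ) *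
        (cmThetaKernelDatum (L : Type) e₁ (frameD V) (frameD_real V) (frameD_ne V) (lineVec (L : Type) (dW S 0))
              (fun _ => dW_real S 0) (fun _ => dW_ne S 0) hGR₀ hρ SK hSK).thetaLift
            (μ'.map (cosetCongr e (relNormOneRat (↥(maximalRealSubfield L)) L)
              (CMRat (L : Type) (lineVec (L : Type) (dW S 0))) hΓ)) Φ f (QuotientGroup.mk (eU x')) := by
  obtain ⟨c, hc, hT⟩ := exists_twist_lineRepOf_zero V S hGR hGR₀ hGR₁ hGR₂ hGR₃ η₀ η₁ η₂ η₃ eU heU e he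
  have hU : ∀ x : ↥(regimeSubgroup L V.Hm), eU x ∈ CMRat (L : Type) (frameD V) ↔ x ∈ P.ΓU := fun x => by
    rw [hPΓ]; exact mem_CMRat_iff_mem_regimeRat V eU heU x
  have hωω' : ∀ (p : ↥(regimeSubgroup L V.Hm) × ↥(relNormOneIdeles (↥(maximalRealSubfield L)) L))
      (Φ : piSchwartzBruhat (↥(maximalRealSubfield L)) (Fin 3)),
      P.ω p Φ = ((c p : ℂˣ) : ℂ) • cmPairRep (L : Type) e₁ (frameD V) (frameD_real V) (frameD_ne V) (lineVec (L : Type) (dW S 0))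
        (fun _ => dW_real S 0) (fun _ => dW_ne S 0) hGR₀ (eU p.1, e p.2) Φ := fun p Φ => by
    rw [hPω]; exact hT p Φ
  have hκ' : ∀ t : ↥(relNormOneIdeles (↥(maximalRealSubfield L)) L),
      κ (QuotientGroup.mk t) = ((c (1, t) : ℂˣ) : ℂ) := fun t => by
    rw [hκ, hc]
    simp only [map_one]
  have hκ0 : ∀ q : ↥(relNormOneIdeles (↥(maximalRealSubfield L)) L) ⧸ relNormOneRat (↥(maximalRealSubfield L)) L, κ q ≠ 0 := fun q => by
    induction q using QuotientGroup.induction_on with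
    | H t => rw [hκ' t]; exact Units.ne_zero _
  let c₂ : C(↥(relNormOneIdeles (↥(maximalRealSubfield L)) L) ⧸ relNormOneRat (↥(maximalRealSubfield L)) L, ℂ) :=
    ⟨fun q => (κ q)⁻¹, κ.continuous.inv₀ hκ0⟩
  have hc₂ : ∀ t : ↥(relNormOneIdeles (↥(maximalRealSubfield L)) L), c₂ (QuotientGroup.mk t) = (((c (1, t))⁻¹ : ℂˣ) : ℂ) := fun t => by
    simp only [c₂, ContinuousMap.coe_mk, hκ' t, Units.val_inv_eq_inv_val]
  obtain ⟨c₁, hc₁⟩ := exists_twist_descend_left (ΓU := CMRat (L : Type) (frameD V))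
    (Γ := CMRat (L : Type) (lineVec (L : Type) (dW S 0))) (ΓU' := P.ΓU)
    (Γ' := relNormOneRat (↥(maximalRealSubfield L)) L)
    (cmPairRep (L : Type) e₁ (frameD V) (frameD_real V) (frameD_ne V) (lineVec (L : Type) (dW S 0)) (fun _ => dW_real S 0)
      (fun _ => dW_ne S 0) hGR₀)
    (fun γU hγU γ hγ => cmPairRep_toHomUnits_mem_thetaStabilizer (L : Type) e₁ (frameD V) (frameD_real V) (frameD_ne V)
      (lineVec (L : Type) (dW S 0)) (fun _ => dW_real S 0) (fun _ => dW_ne S 0) hGR₀ hγU hγ)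
    P.ω P.toHomUnits_mem_thetaStabilizer eU hU e hΓ c hωω'
  have key := thetaLift_apply_of_twist (ΓU := CMRat (L : Type) (frameD V))
    (Γ := CMRat (L : Type) (lineVec (L : Type) (dW S 0))) (ΓU' := P.ΓU)
    (Γ' := relNormOneRat (↥(maximalRealSubfield L)) L)
    (cmPairRep (L : Type) e₁ (frameD V) (frameD_real V) (frameD_ne V) (lineVec (L : Type) (dW S 0)) (fun _ => dW_real S 0)
      (fun _ => dW_ne S 0) hGR₀)
    hρ
    (fun γU hγU γ hγ => cmPairRep_toHomUnits_mem_thetaStabilizer (L : Type) e₁ (frameD V) (frameD_real V) (frameD_ne V)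
      (lineVec (L : Type) (dW S 0)) (fun _ => dW_real S 0) (fun _ => dW_ne S 0) hGR₀ hγU hγ)
    SK hSK P.ω P.majorants P.toHomUnits_mem_thetaStabilizer Set.univ (fun _ _ _ => Set.mem_univ _) eU hU e hΓ c hωω' μ'
    hcont hconts c₁ hc₁ c₂ hc₂ Φ
    (f.comp ⟨cosetCongr e (relNormOneRat (↥(maximalRealSubfield L)) L) (CMRat (L : Type) (lineVec (L : Type) (dW S 0))) hΓ,
      continuous_cosetCongr e _ _ hΓ hcont⟩ * κ)
    (QuotientGroup.mk x')
  have hf : (c₂ * (f.comp ⟨cosetCongr e (relNormOneRat (↥(maximalRealSubfield L)) L) (CMRat (L : Type) (lineVec (L : Type) (dW S 0))) hΓ,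
        continuous_cosetCongr e _ _ hΓ hcont⟩ * κ)).comp
      ⟨cosetCongr e.symm (CMRat (L : Type) (lineVec (L : Type) (dW S 0))) (relNormOneRat (↥(maximalRealSubfield L)) L)
          (forall_symm_mem_iff e _ _ hΓ),
        continuous_cosetCongr e.symm _ _ (forall_symm_mem_iff e _ _ hΓ) hconts⟩ = f := by
    ext q
    induction q using QuotientGroup.induction_on with
    | H h =>
      show c₂ (QuotientGroup.mk (e.symm h)) * (f (QuotientGroup.mk (e (e.symm h))) * κ (QuotientGroup.mk (e.symm h))) =
        f (QuotientGroup.mk h)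
      rw [MulEquiv.apply_symm_apply]
      have h0 := hκ0 (QuotientGroup.mk (e.symm h))
      simp only [c₂, ContinuousMap.coe_mk]
      field_simp
  have hc₁x : c₁ (QuotientGroup.mk x') =
      (((η₀ (eU x', 1) *
          cmLineChar₀ (L : Type) finProdFinEquiv e₁ (frameD V) (frameD_real V) (frameD_ne V) (dW S) (dW_real S) (dW_ne S)
            hGR hGR₀ hGR₁ (eU x', 1))⁻¹ : ℂˣ) : ℂ) := by
    rw [hc₁, hc]
    simp only [map_one]
  rw [hf, hc₁x] at key
  exact key

include heU he hρ hSK in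
/-- **H1 «KERNEL IDENTITY» (socket #20a line): the model's slot-0 lift IS the `s₀ ⊗ ĉ`-lift of the CM dual pair, POINTWISE, NO `U(V)` SCALAR.**  For a pair datum `P`
on the regime carrier with `P.ΓU = regimeRat` and `P.ω = lineRepOf … (etaT₀ 1 ν) η₁ η₂ η₃ 0` for the ENGINE's knob `ν := χ₀(·,1)·(ĉ ∘ ι_V)⁻¹` (★ `H413ThetaDistAtLine.sideAt`
with `η := 1`, `ν := knobNu ĉ`, `rfl` — ★ `sideAt_P_ω`), `ĉ` twisting `s₀ := splittingOf hGR₀` to the compatible `s₀ ⊗ ĉ` (for the engine: the `μ`-splitting,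
★ `exists_coinv_equiv_TW_splittingOf_adelic`), `κ₁` ∕ `κ₂` the continuous multipliers descending `t ↦ η₀(1, t♭)·χ₀(1, e t)` ∕ `h ↦ ĉ(1 ⊗ h)`:
`P.kernelDatum.thetaLift μ′ Φ ((f ∘ a)·κ₁) (x′Γ) = Θ^{s₀ ⊗ ĉ}_Φ(f·κ₂)(x̂ Γ)` against `a_* μ′` — §2 gives `(η₀(x̂,1)·χ₀(x̂,1))⁻¹ · Θ^{s₀}_Φ(f)(x̂Γ)`, §3 rewrites the scalar as
`ĉ(x̂ ⊗ 1)⁻¹`, §1 says that is `Θ^{s₀⊗ĉ}_Φ(f·κ₂)(x̂Γ)`.  The FUNCTION-level content of the three ★ «≠ 0 iff» bridges of `H413ThetaDistNeZeroOfThetaLift`, twist computed TRIVIAL.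
[cite: GelbartRogawski1991, §3.1 Prop. 3.1.1 p. 455; Remark p. 457 L4–13] [cite: Weil1964, Chap. III n° 41 Thm 6 p. 193] [cite: Howe1979, §3]
[cite: Liu2021, App. D §D.1 Steps 1–3 (l. 5215–5221)] [cite: FleigEtAl2018, §12.3 Def. 12.5 (12.37)] -/
theorem kernelDatum_thetaLift_eq_twist_splitting_thetaLift
  (ĉ : ↥(UnitaryGroup.adelicPair (↥(maximalRealSubfield L)) (L : Type) (IsCMField.complexConj L) 3 1 (Matrix.diagonal (frameD V))
        (Matrix.diagonal (lineVec (L : Type) (dW S 0)))) →* ℂˣ)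
  (P : WeilPairData (↥(maximalRealSubfield L)) (L : Type) (Fin 3) ↥(regimeSubgroup L V.Hm))
    (hPω : P.ω = lineRepOf V S hGR hGR₀ hGR₁ hGR₂ hGR₃
      (etaT₀ V S (1 : CMAdelic (L : Type) (frameD V) × CMAdelic (L : Type) (dW S) →* ℂˣ)
        ((cmLineChar₀ (L : Type) finProdFinEquiv e₁ (frameD V) (frameD_real V) (frameD_ne V) (dW S) (dW_real S) (dW_ne S) hGR hGR₀ hGR₁).comp
            (MonoidHom.inl _ _) *
          (ĉ.comp (UnitaryGroup.adelicInl (↥(maximalRealSubfield L)) (L : Type) (IsCMField.complexConj L) 3 1 (Matrix.diagonal (frameD V))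
            (Matrix.diagonal (lineVec (L : Type) (dW S 0)))))⁻¹))
      η₁ η₂ η₃ 0)
    (hPΓ : P.ΓU = regimeRat L V.Hm)
    [CompactSpace (↥(regimeSubgroup L V.Hm) ⧸ P.ΓU)]
    (hs' : (cmSplittingDatum (L : Type) (e₁) (frameD V) (frameD_real V) (frameD_ne V) (lineVec (L : Type) (dW S 0))
        (fun _ => dW_real S 0) (fun _ => dW_ne S 0)).IsCompatible
      (adelicMpCont.twist (↥(maximalRealSubfield L)) (Fin 3) _
        (splittingOf _ _ _ _ _ _ _ _ _ _ _ _ _ _ _ _ _ hGR₀) ĉ))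
    (hρ' : HasThetaMajorants fun
      (p : CMAdelic (L : Type) (frameD V) × CMAdelic (L : Type) (lineVec (L : Type) (dW S 0)))
      (Φ : piSchwartzBruhat (↥(maximalRealSubfield L)) (Fin 3)) =>
        pairRep (↥(maximalRealSubfield L)) (L : Type) (IsCMField.complexConj L) 3 1 e₁ (Matrix.diagonal (frameD V))
          (Matrix.diagonal (lineVec (L : Type) (dW S 0)))
          (adelicMpCont.twist (↥(maximalRealSubfield L)) (Fin 3) _ (splittingOf _ _ _ _ _ _ _ _ _ _ _ _ _ _ _ _ _ hGR₀) ĉ) p Φ)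
    (SK' : Set (piSchwartzBruhat (↥(maximalRealSubfield L)) (Fin 3)))
    (hSK' : ∀ (h : CMAdelic (L : Type) (lineVec (L : Type) (dW S 0))) (Φ : piSchwartzBruhat (↥(maximalRealSubfield L)) (Fin 3)),
      Φ ∈ SK' → pairRep (↥(maximalRealSubfield L)) (L : Type) (IsCMField.complexConj L) 3 1 e₁ (Matrix.diagonal (frameD V))
          (Matrix.diagonal (lineVec (L : Type) (dW S 0)))
          (adelicMpCont.twist (↥(maximalRealSubfield L)) (Fin 3) _ (splittingOf _ _ _ _ _ _ _ _ _ _ _ _ _ _ _ _ _ hGR₀) ĉ) (1, h) Φ ∈ SK')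
    (hcont : Continuous e) (hconts : Continuous e.symm)
    (κ₁ : C(↥(relNormOneIdeles (↥(maximalRealSubfield L)) L) ⧸ relNormOneRat (↥(maximalRealSubfield L)) L, ℂ))
    (hκ₁ : ∀ t : ↥(relNormOneIdeles (↥(maximalRealSubfield L)) L),
      κ₁ (QuotientGroup.mk t) =
        ((etaT₀ V S (1 : CMAdelic (L : Type) (frameD V) × CMAdelic (L : Type) (dW S) →* ℂˣ)
              ((cmLineChar₀ (L : Type) finProdFinEquiv e₁ (frameD V) (frameD_real V) (frameD_ne V) (dW S) (dW_real S) (dW_ne S) hGR hGR₀ hGR₁).comp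
                  (MonoidHom.inl _ _) *
                (ĉ.comp (UnitaryGroup.adelicInl (↥(maximalRealSubfield L)) (L : Type) (IsCMField.complexConj L) 3 1 (Matrix.diagonal (frameD V))
                  (Matrix.diagonal (lineVec (L : Type) (dW S 0)))))⁻¹)
              (1, (cmAdelicOneEquivRelNormOne (L : Type)).symm t) *
            cmLineChar₀ (L : Type) finProdFinEquiv e₁ (frameD V) (frameD_real V) (frameD_ne V) (dW S) (dW_real S) (dW_ne S)
              hGR hGR₀ hGR₁ (1, e t) : ℂˣ) : ℂ))
    (κ₂ : C(CMAdelic (L : Type) (lineVec (L : Type) (dW S 0)) ⧸ CMRat (L : Type) (lineVec (L : Type) (dW S 0)), ℂ))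
    (hκ₂ : ∀ h : CMAdelic (L : Type) (lineVec (L : Type) (dW S 0)),
      κ₂ (QuotientGroup.mk h) =
        ((ĉ (UnitaryGroup.adelicInr (↥(maximalRealSubfield L)) (L : Type) (IsCMField.complexConj L) 3 1 (Matrix.diagonal (frameD V))
          (Matrix.diagonal (lineVec (L : Type) (dW S 0))) h) : ℂˣ) : ℂ))
    (Φ : piSchwartzBruhat (↥(maximalRealSubfield L)) (Fin 3))
    (f : C(CMAdelic (L : Type) (lineVec (L : Type) (dW S 0)) ⧸ CMRat (L : Type) (lineVec (L : Type) (dW S 0)), ℂ))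
    (x' : ↥(regimeSubgroup L V.Hm)) :
    P.kernelDatum.thetaLift μ' (P.weilDatum.toThetaTop Φ)
        (f.comp ⟨cosetCongr e (relNormOneRat (↥(maximalRealSubfield L)) L) (CMRat (L : Type) (lineVec (L : Type) (dW S 0))) hΓ,
          continuous_cosetCongr e _ _ hΓ hcont⟩ * κ₁) (QuotientGroup.mk x') =
      (thetaKernelDatum (↥(maximalRealSubfield L)) (L : Type) (IsCMField.complexConj L) 3 1 e₁ (Matrix.diagonal (frameD V))
            (Matrix.diagonal (lineVec (L : Type) (dW S 0))) (complexConj_imagUnit L) (imagUnit_ne_zero L) (imagUnit_mul_self L)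
            (realDiagonal_isSymm L (frameD V) (frameD_real V)) (realDiagonal_isSymm L _ (fun _ => dW_real S 0))
            (isUnit_det_realDiagonal L (frameD V) (frameD_real V) (frameD_ne V))
            (isUnit_det_realDiagonal L _ (fun _ => dW_real S 0) (fun _ => dW_ne S 0))
            (realDiagonal_map L (frameD V) (frameD_real V)).symm (realDiagonal_map L _ (fun _ => dW_real S 0)).symm
            (adelicMpCont.twist (↥(maximalRealSubfield L)) (Fin 3) _ (splittingOf _ _ _ _ _ _ _ _ _ _ _ _ _ _ _ _ _ hGR₀) ĉ)
            hs' hρ' SK' hSK').thetaLift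
          (μ'.map (cosetCongr e (relNormOneRat (↥(maximalRealSubfield L)) L) (CMRat (L : Type) (lineVec (L : Type) (dW S 0))) hΓ))
          Φ (f * κ₂) (QuotientGroup.mk (eU x')) := by
  rw [kernelDatum_thetaLift_comp_mul_apply_mk V S hGR hGR₀ hGR₁ hGR₂ hGR₃ _ η₁ η₂ η₃ eU heU e he hΓ hρ SK hSK μ' P hPω hPΓ hcont hconts
    κ₁ hκ₁ Φ f x']
  rw [etaT₀_one_knob_mul_cmLineChar₀ V S hGR hGR₀ hGR₁ _ (eU x'), MonoidHom.comp_apply]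
  exact (thetaLift_twist_splitting_mul_apply_mk (↥(maximalRealSubfield L)) (L : Type) (IsCMField.complexConj L) 3 1 e₁
    (Matrix.diagonal (frameD V)) (Matrix.diagonal (lineVec (L : Type) (dW S 0))) (complexConj_imagUnit L) (imagUnit_ne_zero L)
    (imagUnit_mul_self L) (realDiagonal_isSymm L (frameD V) (frameD_real V)) (realDiagonal_isSymm L _ (fun _ => dW_real S 0))
    (isUnit_det_realDiagonal L (frameD V) (frameD_real V) (frameD_ne V))
    (isUnit_det_realDiagonal L _ (fun _ => dW_real S 0) (fun _ => dW_ne S 0))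
    (realDiagonal_map L (frameD V) (frameD_real V)).symm (realDiagonal_map L _ (fun _ => dW_real S 0)).symm
    (splittingOf_isCompatible _ _ _ _ _ _ _ _ _ _ _ _ _ _ _ _ _ hGR₀) ĉ hs' hρ SK hSK hρ' SK' hSK'
    (μ'.map (cosetCongr e (relNormOneRat (↥(maximalRealSubfield L)) L) (CMRat (L : Type) (lineVec (L : Type) (dW S 0))) hΓ))
    κ₂ hκ₂ Φ f (eU x')).symm

end Model

end Summit.HodgeConjecture.HodgeConjecture.Cruxes.H413.K2E2CapArchKernelIdentity

end
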